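import Literature.MathematicalPhysics.QuantumLattice.BdGBondHamiltonian
import Literature.MathematicalPhysics.QuantumLattice.PartialParticleHoleQuadratic
import Literature.MathematicalPhysics.QuantumLattice.FreeFermionSpinTwistedTraceFormula
import Literature.MathematicalPhysics.QuantumLattice.DuhamelTwoPoint
import Literature.MathematicalPhysics.QuantumLattice.SpinOperatorsProofs
import HarnessLib

/-!
# The BdG Hamiltonian with bond data is a free Fermi gas after Lieb's partial particle–hole transformation

Topic `Literature/MathematicalPhysics/QuantumLattice` (family `hubbard`). For the tree's lattice
Bogoliubov–de Gennes Hamiltonian with ARBITRARY (inhomogeneous) bond data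
`bdgBondHamiltonian τ Δ μ = Σ_{x,y,σ} τ(x,y) c†_{xσ}c_{yσ} + (Σ_{x,y} Δ(x,y)(c_{x↑}c_{y↓} - c_{x↓}c_{y↑}) + h.c.) - μN`
(`BdGBondHamiltonian.lean`) we prove, using the partial particle–hole transformation
`W = partialParticleHole D↓` on the spin-down orbitals (`PartialParticleHole(Quadratic).lean`:
`c_{x↓} ↦ c†_{x↓}`, `c_{x↑} ↦ c_{x↑}`, no residual Jordan–Wigner signs):

* `partialParticleHole_conj_bdgBondHamiltonian` — **`W H_BdG(τ,Δ,μ) Wᴴ = dΓ(𝓗) + C·1`** with the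
  particle-number CONSERVING one-body ("Nambu") matrix `𝓗 = bdgNambuMatrix τ Δ μ` on `Orb Λ`
  (blocks `τ - μ` on `↑↑`, `-(τ - μ)ᵀ` on `↓↓`, `-(Δ + Δᵀ)` on `↓↑` and its adjoint on `↑↓`,
  `bdgNambuMatrix_orb_orb`) and the c-number `C = Σ_x (τ(x,x) - μ)`;
* `partitionFn_bdgBondHamiltonian` — hence, for Hermitian hopping, the **determinant formula**
  `tr e^{-β H_BdG} = e^{-βC} det(1 + e^{-β𝓗})` (the tree's free-fermion trace formula
  `partitionFn_dGamma_eq_det` applied after the transformation), valid for every phase / vortex /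
  flux texture encoded in `(τ, Δ)`;
* `trace_bdgNambuMatrix` — `tr 𝓗 = 0`, and `isHermitian_bdgNambuMatrix`.

This is the device by which Bach–Lieb–Solovej reduce quasi-free states WITH pairing to ordinary
one-particle density matrices (J. Stat. Phys. 76 (1994) 3, §2: the particle–hole transformation
and Theorem 2.3), written for Hamiltonians: the BCS/BdG mean-field Hamiltonian is unitarily a free
Fermi gas, so its thermodynamics is a determinant (de Gennes 1966, Ch. 5, eqs. (5-12), (5-18) and
§5-3; for the translation-invariant `d`-wave source the tree already has the momentum-space product
`partitionFn_dWaveSourceTorus_zero`). The two-sided eigenvalue bounds on `det(1 + e^{-β𝓗})` and the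
resulting quasi-free ground-state energy `C - ½Σ_i|λ_i(𝓗)|` are in the companion file
`BdGBondHamiltonianFreeEnergyBounds.lean`.

All statements are finite-dimensional algebra and fully proved (no placeholders, no named facts).

## Mathlib / tree search

REUSED (tree): `bdgBondHamiltonian`, `bdgHopping_eq`, `bdgPairing_eq` (`BdGBondHamiltonian`);
`partialParticleHole`, `partialParticleHole_conj_dGamma`, `partialParticleHole_conj_pairSum`,
`phOneBody`, `phPairOneBody`, `partialParticleHole_mem_unitaryGroup` (`PartialParticleHole*`);
`dGamma`, `dGamma_add/sub/smul/conjTranspose`, `dGamma_smul_one`, `totalNumberOp_eq_totalNumber`,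
`sum_orb_eq_sum_sum`, `ofLex_orb`, `exp_smul_one_sub_smul` (`FermionQuasiFree`,
`FreeFermion(Spin)TwistedTraceFormula`); `partitionFn_dGamma_eq_det_holds`
(`FreeFermionTraceFormulaProofs`); `Matrix.partitionFn_unitary_conj` (`DuhamelTwoPoint`);
`annihilation_anticommute_holds` (`HubbardWave0Proofs`). Mathlib: `Matrix.isHermitian_add_transpose_self`,
`Finset.sum_filter`, `Finset.sum_ite_eq`. Nothing pre-existing computes `tr e^{-βH}` for a BdG
Hamiltonian with inhomogeneous bond data (`lean search 'partitionFn_bdg|bdg.*det'`: no hits).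

## References

* V. Bach, E. H. Lieb, J. P. Solovej, *Generalized Hartree–Fock theory and the Hubbard model*,
  J. Stat. Phys. 76 (1994) 3–89, §2 (particle–hole transformation, Theorem 2.3). [BachLiebSolovej1994]
* E. H. Lieb, *Two theorems on the Hubbard model*, PRL 62 (1989) 1201, proof of Theorem 2. [Lieb1989]
* P. G. de Gennes, *Superconductivity of Metals and Alloys* (1966), Ch. 5. [deGennes1966]
* J. Dereziński, C. Gérard, *Mathematics of Quantization and Quantum Fields* (2013/2022), §17.2
  (`Tr Γ(γ) = det(1 + γ)`). [DerezinskiGerard2022]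
-/

noncomputable section

namespace Literature.MathematicalPhysics.QuantumLattice

open Matrix Finset HubbardWave0 NormedSpace
open scoped ComplexOrder ComplexConjugate

variable {Λ : Type*} [LinearOrder Λ] [Fintype Λ]

/-! ### The spin-down orbitals and the one-body matrices -/

/-- The set `D↓ = {(x,↓) : x ∈ Λ}` of spin-down orbitals, on which Lieb's partial particle–hole
transformation `c_{x↓} ↦ c†_{x↓}` acts (Lieb 1989, proof of Thm 2). [cite: Lieb1989, proof of Theorem 2] -/
def spinDownOrbitals : Finset (Orb Λ) := Finset.univ.filter fun o => (ofLex o).2 = 1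

omit [LinearOrder Λ] in
/-- `(x,σ) ∈ D↓ ↔ σ = ↓`. [folklore] -/
@[simp] theorem orb_mem_spinDownOrbitals_iff (x : Λ) (σ : Fin 2) :
    orb x σ ∈ (spinDownOrbitals : Finset (Orb Λ)) ↔ σ = 1 := by
  simp [spinDownOrbitals]

/-- The spin-diagonal one-body matrix `τ ⊗ 1₂` of a spin-independent hopping:
`(τ ⊗ 1₂)_{(x,σ),(y,σ')} = δ_{σσ'} τ(x,y)`. [folklore] -/
def bdgHopOneBody (τ : Λ → Λ → ℂ) : Matrix (Orb Λ) (Orb Λ) ℂ :=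
  Matrix.of fun o o' => if (ofLex o).2 = (ofLex o').2 then τ (ofLex o).1 (ofLex o').1 else 0

omit [LinearOrder Λ] [Fintype Λ] in
/-- Entries of `bdgHopOneBody` on orbitals. [folklore] -/
@[simp] theorem bdgHopOneBody_orb (τ : Λ → Λ → ℂ) (x y : Λ) (σ σ' : Fin 2) :
    bdgHopOneBody τ (orb x σ) (orb y σ') = if σ = σ' then τ x y else 0 := rfl

/-- The symmetrised, spin-blind pair coupling `G_{(x,σ),(y,σ')} = Δ(x,y) + Δ(y,x)` (only its
`↑↓` entries are used). [folklore] -/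
def bdgPairCoupling (Δ : Λ → Λ → ℂ) : Matrix (Orb Λ) (Orb Λ) ℂ :=
  Matrix.of fun o o' => Δ (ofLex o).1 (ofLex o').1 + Δ (ofLex o').1 (ofLex o).1

omit [LinearOrder Λ] [Fintype Λ] in
/-- Entries of `bdgPairCoupling` on orbitals. [folklore] -/
@[simp] theorem bdgPairCoupling_orb (Δ : Λ → Λ → ℂ) (x y : Λ) (σ σ' : Fin 2) :
    bdgPairCoupling Δ (orb x σ) (orb y σ') = Δ x y + Δ y x := rfl

/-- **The Nambu one-body matrix** of `bdgBondHamiltonian τ Δ μ` after the partial particle–hole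
transformation on the spin-down orbitals: the `ph`-transform of `τ ⊗ 1₂ - μ` (blocks `τ - μ` and
`-(τ - μ)ᵀ`) minus the hopping `G^{ph} + (G^{ph})ᴴ` produced by the pair terms
(Bach–Lieb–Solovej 1994 §2; de Gennes 1966 eq. (5-18)). Its entries are listed in
`bdgNambuMatrix_orb_orb`. [cite: BachLiebSolovej1994, §2] -/
def bdgNambuMatrix (τ Δ : Λ → Λ → ℂ) (μ : ℝ) : Matrix (Orb Λ) (Orb Λ) ℂ :=
  phOneBody spinDownOrbitals (bdgHopOneBody τ - (μ : ℂ) • (1 : Matrix (Orb Λ) (Orb Λ) ℂ)) -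
    (phPairOneBody spinDownOrbitals (bdgPairCoupling Δ) +
      (phPairOneBody spinDownOrbitals (bdgPairCoupling Δ))ᴴ)

/-- **Entries of the Nambu matrix**: `𝓗_{(x↑),(y↑)} = τ(x,y) - μδ_{xy}`,
`𝓗_{(x↓),(y↓)} = -τ(y,x) + μδ_{xy}`, `𝓗_{(x↓),(y↑)} = -(Δ(x,y) + Δ(y,x))`,
`𝓗_{(x↑),(y↓)} = -conj(Δ(x,y) + Δ(y,x))`. [cite: BachLiebSolovej1994, §2] -/
theorem bdgNambuMatrix_orb_orb (τ Δ : Λ → Λ → ℂ) (μ : ℝ) (x y : Λ) (σ σ' : Fin 2) :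
    bdgNambuMatrix τ Δ μ (orb x σ) (orb y σ') =
      if σ = 0 then
        (if σ' = 0 then τ x y - (if x = y then (μ : ℂ) else 0) else -(star (Δ x y + Δ y x)))
      else
        (if σ' = 0 then -(Δ x y + Δ y x) else -τ y x + (if x = y then (μ : ℂ) else 0)) := by
  simp only [bdgNambuMatrix, Matrix.sub_apply, Matrix.add_apply, phOneBody_apply,
    phPairOneBody_apply, conjTranspose_apply, orb_mem_spinDownOrbitals_iff, Matrix.smul_apply,
    Matrix.one_apply, orb_eq_orb_iff, bdgHopOneBody_orb, bdgPairCoupling_orb, smul_eq_mul]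
  fin_cases σ <;> fin_cases σ' <;> simp [@eq_comm _ y x] <;> ring

/-- The Nambu matrix is traceless: the `↑↑` block `τ - μ` and the `↓↓` block `-(τ - μ)ᵀ` cancel.
[folklore] -/
theorem trace_bdgNambuMatrix (τ Δ : Λ → Λ → ℂ) (μ : ℝ) : (bdgNambuMatrix τ Δ μ).trace = 0 := by
  rw [Matrix.trace, sum_orb_eq_sum_sum]
  refine Finset.sum_eq_zero fun x _ => ?_
  rw [Fin.sum_univ_two, Matrix.diag_apply, Matrix.diag_apply, bdgNambuMatrix_orb_orb,
    bdgNambuMatrix_orb_orb]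
  simp

/-- The Nambu matrix is Hermitian for Hermitian hopping amplitudes `conj τ(x,y) = τ(y,x)`.
[folklore] -/
theorem isHermitian_bdgNambuMatrix {τ : Λ → Λ → ℂ} (hτ : ∀ x y, star (τ x y) = τ y x)
    (Δ : Λ → Λ → ℂ) (μ : ℝ) : (bdgNambuMatrix τ Δ μ).IsHermitian := by
  have hA : (bdgHopOneBody τ - (μ : ℂ) • (1 : Matrix (Orb Λ) (Orb Λ) ℂ)).IsHermitian := by
    refine Matrix.IsHermitian.sub ?_ ?_
    · refine Matrix.IsHermitian.ext fun o o' => ?_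
      obtain ⟨⟨x, σ⟩, rfl⟩ : ∃ p : Λ × Fin 2, toLex p = o := ⟨ofLex o, rfl⟩
      obtain ⟨⟨y, σ'⟩, rfl⟩ : ∃ p : Λ × Fin 2, toLex p = o' := ⟨ofLex o', rfl⟩
      change star (bdgHopOneBody τ (orb y σ') (orb x σ)) = bdgHopOneBody τ (orb x σ) (orb y σ')
      rw [bdgHopOneBody_orb, bdgHopOneBody_orb]
      by_cases h : σ = σ'
      · subst h; simp [hτ]
      · rw [if_neg (Ne.symm h), if_neg h, star_zero]
    · exact Matrix.isHermitian_one.smul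
        (by rw [IsSelfAdjoint, Complex.star_def, Complex.conj_ofReal] : IsSelfAdjoint (μ : ℂ))
  unfold bdgNambuMatrix
  exact (isHermitian_phOneBody _ hA).sub (Matrix.isHermitian_add_transpose_self _)

/-! ### Block (Nambu) form along `Λ ⊕ Λ ≃ Orb Λ` -/

/-- The Nambu relabelling `Λ ⊕ Λ ≃ Orb Λ`: `inl x ↦ (x,↑)` (particle index), `inr x ↦ (x,↓)`
(hole index after the transformation). [folklore] -/
def nambuEquiv : Λ ⊕ Λ ≃ Orb Λ where
  toFun := Sum.elim (fun x => orb x 0) (fun x => orb x 1)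
  invFun o := if (ofLex o).2 = 0 then Sum.inl (ofLex o).1 else Sum.inr (ofLex o).1
  left_inv := by
    rintro (x | x) <;> simp
  right_inv := by
    intro o
    obtain ⟨⟨x, σ⟩, rfl⟩ : ∃ p : Λ × Fin 2, toLex p = o := ⟨ofLex o, rfl⟩
    fin_cases σ
    · simp [ofLex_toLex]
    · simp [ofLex_toLex]

omit [LinearOrder Λ] [Fintype Λ] in
/-- `nambuEquiv (inl x) = (x,↑)`. [folklore] -/
@[simp] theorem nambuEquiv_inl (x : Λ) : (nambuEquiv (Sum.inl x) : Orb Λ) = orb x 0 := rfl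

omit [LinearOrder Λ] [Fintype Λ] in
/-- `nambuEquiv (inr x) = (x,↓)`. [folklore] -/
@[simp] theorem nambuEquiv_inr (x : Λ) : (nambuEquiv (Sum.inr x) : Orb Λ) = orb x 1 := rfl

/-- **Block form of the Nambu matrix**: along `Λ ⊕ Λ ≃ Orb Λ`,
`𝓗 = [[τ - μ, -conj P], [-P, -(τ - μ)ᵀ]]` with the symmetrised pairing `P(x,y) = Δ(x,y) + Δ(y,x)`
— de Gennes' Bogoliubov–de Gennes matrix (1966, eq. (5-18)) for bond pairing; for REAL symmetric
hopping `h = τ - μ` and symmetric `D = -conj P` this is `fromBlocks h D Dᴴ (-h)`.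
[cite: deGennes1966, §5-1 eq. (5-18)] -/
theorem reindex_bdgNambuMatrix_eq_fromBlocks (τ Δ : Λ → Λ → ℂ) (μ : ℝ) :
    Matrix.reindex nambuEquiv.symm nambuEquiv.symm (bdgNambuMatrix τ Δ μ) =
      Matrix.fromBlocks (Matrix.of τ - (μ : ℂ) • (1 : Matrix Λ Λ ℂ))
        (-(Matrix.of fun x y => Δ x y + Δ y x).map star)
        (-(Matrix.of fun x y => Δ x y + Δ y x))
        (-(Matrix.of τ - (μ : ℂ) • (1 : Matrix Λ Λ ℂ))ᵀ) := by
  ext (x | x) (y | y)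
  · simp [bdgNambuMatrix_orb_orb, Matrix.one_apply]
  · simp [bdgNambuMatrix_orb_orb]
  · simp [bdgNambuMatrix_orb_orb]
  · simp [bdgNambuMatrix_orb_orb, Matrix.one_apply]
    ring

/-- The same identity read as `𝓗 = reindex (fromBlocks …)`. [folklore] -/
theorem bdgNambuMatrix_eq_reindex_fromBlocks (τ Δ : Λ → Λ → ℂ) (μ : ℝ) :
    bdgNambuMatrix τ Δ μ = Matrix.reindex nambuEquiv nambuEquiv
      (Matrix.fromBlocks (Matrix.of τ - (μ : ℂ) • (1 : Matrix Λ Λ ℂ))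
        (-(Matrix.of fun x y => Δ x y + Δ y x).map star)
        (-(Matrix.of fun x y => Δ x y + Δ y x))
        (-(Matrix.of τ - (μ : ℂ) • (1 : Matrix Λ Λ ℂ))ᵀ)) := by
  rw [← reindex_bdgNambuMatrix_eq_fromBlocks]
  ext o o'
  simp

/-! ### The hopping and pairing parts in `dΓ` / pair-sum form -/

/-- Spin-independent hopping is the second quantisation of `τ ⊗ 1₂`:
`Σ_{x,y,σ} τ(x,y) c†_{xσ}c_{yσ} = dΓ(τ ⊗ 1₂)`. [folklore] -/
theorem bdgHopping_eq_dGamma (τ : Λ → Λ → ℂ) : bdgHopping τ = dGamma (bdgHopOneBody τ) := by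
  rw [dGamma_eq, bdgHopping_eq, sum_orb_eq_sum_sum]
  refine Finset.sum_congr rfl fun x _ => ?_
  rw [Finset.sum_comm]
  refine Finset.sum_congr rfl fun σ _ => ?_
  rw [sum_orb_eq_sum_sum]
  refine Finset.sum_congr rfl fun y _ => ?_
  simp only [bdgHopOneBody_orb, ite_smul, zero_smul, Finset.sum_ite_eq, Finset.mem_univ, if_true]

/-- The singlet pairing part as a pair sum over (spin-up, spin-down) orbitals:
`Σ_{x,y} Δ(x,y)(c_{x↑}c_{y↓} - c_{x↓}c_{y↑}) = Σ_{i ∉ D↓, j ∈ D↓} G_{ij} c_i c_j` with the symmetrised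
coupling `G` (`c_{x↓}c_{y↑} = -c_{y↑}c_{x↓}`). [folklore] -/
theorem bdgPairing_eq_pairSum (Δ : Λ → Λ → ℂ) :
    bdgPairing Δ = ∑ i : Orb Λ, ∑ j : Orb Λ,
      if i ∉ (spinDownOrbitals : Finset (Orb Λ)) ∧ j ∈ (spinDownOrbitals : Finset (Orb Λ)) then
        bdgPairCoupling Δ i j • (annihilation i * annihilation j) else 0 := by
  have hanti : ∀ x y : Λ, annihilation (orb x 1) * annihilation (orb y 0) =
      -(annihilation (orb y 0) * annihilation (orb x 1) :
        Matrix (Finset (Orb Λ)) (Finset (Orb Λ)) ℂ) :=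
    fun x y => eq_neg_of_add_eq_zero_left (annihilation_anticommute_holds _ _)
  have hL : bdgPairing Δ = ∑ x : Λ, ∑ y : Λ,
      (Δ x y + Δ y x) • (annihilation (orb x 0) * annihilation (orb y 1)) := by
    rw [bdgPairing_eq]
    simp_rw [hanti, sub_neg_eq_add, smul_add, add_smul, Finset.sum_add_distrib]
    congr 1
    rw [Finset.sum_comm]
  rw [hL, sum_orb_eq_sum_sum]
  refine Finset.sum_congr rfl fun x _ => ?_
  rw [Fin.sum_univ_two]
  have h2 : ∑ j : Orb Λ, (if orb x 1 ∉ (spinDownOrbitals : Finset (Orb Λ)) ∧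
      j ∈ (spinDownOrbitals : Finset (Orb Λ)) then
        bdgPairCoupling Δ (orb x 1) j • (annihilation (orb x 1) * annihilation j) else 0) = 0 := by
    refine Finset.sum_eq_zero fun j _ => ?_
    rw [if_neg]
    simp
  rw [h2, add_zero, sum_orb_eq_sum_sum]
  refine Finset.sum_congr rfl fun y _ => ?_
  rw [Fin.sum_univ_two]
  simp

/-! ### Conjugation by the partial particle–hole transformation -/

/-- The diagonal sum of `τ ⊗ 1₂ - μ` over the spin-down orbitals is `Σ_x (τ(x,x) - μ)`. [folklore] -/
theorem sum_spinDownOrbitals_diag (τ : Λ → Λ → ℂ) (μ : ℝ) :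
    ∑ i ∈ (spinDownOrbitals : Finset (Orb Λ)),
        (bdgHopOneBody τ - (μ : ℂ) • (1 : Matrix (Orb Λ) (Orb Λ) ℂ)) i i =
      ∑ x : Λ, (τ x x - μ) := by
  rw [spinDownOrbitals, Finset.sum_filter, sum_orb_eq_sum_sum]
  refine Finset.sum_congr rfl fun x _ => ?_
  rw [Fin.sum_univ_two]
  simp

/-- **Lieb's partial particle–hole transformation turns the BdG Hamiltonian into a free Fermi gas**:
`W H_BdG(τ,Δ,μ) Wᴴ = dΓ(𝓗) + (Σ_x (τ(x,x) - μ))·1` with `𝓗 = bdgNambuMatrix τ Δ μ`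
(`W = partialParticleHole D↓`). Bach–Lieb–Solovej 1994 §2; Lieb 1989, proof of Thm 2.
[cite: BachLiebSolovej1994, §2] -/
theorem partialParticleHole_conj_bdgBondHamiltonian (τ Δ : Λ → Λ → ℂ) (μ : ℝ) :
    partialParticleHole spinDownOrbitals * bdgBondHamiltonian τ Δ μ *
        (partialParticleHole spinDownOrbitals)ᴴ =
      dGamma (bdgNambuMatrix τ Δ μ) +
        (∑ x : Λ, (τ x x - μ)) • (1 : Matrix (Finset (Orb Λ)) (Finset (Orb Λ)) ℂ) := by
  set D : Finset (Orb Λ) := spinDownOrbitals with hD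
  set W := partialParticleHole D with hW
  set A : Matrix (Orb Λ) (Orb Λ) ℂ := bdgHopOneBody τ - (μ : ℂ) • 1 with hA
  set G : Matrix (Orb Λ) (Orb Λ) ℂ := bdgPairCoupling Δ with hG
  -- the number-conserving part
  have hquad : bdgHopping τ - (μ : ℂ) • (totalNumber : Matrix (Finset (Orb Λ)) (Finset (Orb Λ)) ℂ) =
      dGamma A := by
    rw [hA, dGamma_sub, dGamma_smul_one, totalNumberOp_eq_totalNumber, bdgHopping_eq_dGamma]
  have hblock : ∀ i j, i ∈ D → j ∉ D → A i j = 0 ∧ A j i = 0 := by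
    intro i j hi hj
    obtain ⟨⟨x, σ⟩, rfl⟩ : ∃ p : Λ × Fin 2, toLex p = i := ⟨ofLex i, rfl⟩
    obtain ⟨⟨y, σ'⟩, rfl⟩ : ∃ p : Λ × Fin 2, toLex p = j := ⟨ofLex j, rfl⟩
    change orb x σ ∈ D at hi
    change orb y σ' ∉ D at hj
    rw [hD, orb_mem_spinDownOrbitals_iff] at hi hj
    have hne : σ ≠ σ' := fun h => hj (h ▸ hi)
    have hne' : ¬ (x = y ∧ σ = σ') := fun h => hne h.2
    have hne'' : ¬ (y = x ∧ σ' = σ) := fun h => hne h.2.symm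
    change A (orb x σ) (orb y σ') = 0 ∧ A (orb y σ') (orb x σ) = 0
    simp only [hA, Matrix.sub_apply, bdgHopOneBody_orb, if_neg hne, if_neg hne.symm,
      Matrix.smul_apply, Matrix.one_apply, orb_eq_orb_iff, if_neg hne', if_neg hne'', smul_zero,
      sub_zero, and_self]
  have hconjA : W * dGamma A * Wᴴ = dGamma (phOneBody D A) +
      (∑ x : Λ, (τ x x - μ)) • (1 : Matrix (Finset (Orb Λ)) (Finset (Orb Λ)) ℂ) := by
    rw [hW, partialParticleHole_conj_dGamma D A hblock, hA, hD, sum_spinDownOrbitals_diag]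
  -- the pairing part and its adjoint
  have hconjP : W * bdgPairing Δ * Wᴴ = -dGamma (phPairOneBody D G) := by
    rw [bdgPairing_eq_pairSum, hW, hG, hD]
    exact partialParticleHole_conj_pairSum _ _
  have hconjPH : W * (bdgPairing Δ)ᴴ * Wᴴ = -dGamma (phPairOneBody D G)ᴴ := by
    have h := congrArg conjTranspose hconjP
    rw [conjTranspose_mul, conjTranspose_mul, conjTranspose_conjTranspose, ← Matrix.mul_assoc,
      conjTranspose_neg, dGamma_conjTranspose] at h
    exact h
  -- assemble
  have hsplit : bdgBondHamiltonian τ Δ μ =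
      (bdgHopping τ - (μ : ℂ) • totalNumber) + bdgPairing Δ + (bdgPairing Δ)ᴴ := by
    rw [bdgBondHamiltonian_eq]; abel
  rw [hsplit, Matrix.mul_add, Matrix.add_mul, Matrix.mul_add, Matrix.add_mul, hquad, hconjA,
    hconjP, hconjPH, bdgNambuMatrix, ← hD, ← hA, ← hG, dGamma_sub, dGamma_add]
  abel

/-! ### The determinant formula for the partition function -/

/-- The Gibbs weight of `X + C·1` factorises: `e^{-β(X + C·1)} = e^{-βC} e^{-βX}`. [folklore] -/
theorem gibbsWeight_add_smul_one {n : Type*} [Fintype n] [DecidableEq n] (β : ℝ)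
    (X : Matrix n n ℂ) (C : ℂ) :
    gibbsWeight β (X + C • (1 : Matrix n n ℂ)) = Complex.exp (-(β : ℂ) * C) • gibbsWeight β X := by
  have hcomm : Commute ((-(β : ℂ) * C) • (1 : Matrix n n ℂ)) (-(β : ℂ) • X) :=
    ((Commute.one_left X).smul_left _).smul_right _
  rw [gibbsWeight, gibbsWeight, smul_add, smul_smul, add_comm, Matrix.exp_add_of_commute _ _ hcomm,
    exp_smul_one_eq, Matrix.smul_mul, Matrix.one_mul]

/-- `tr e^{-β dΓ(h)} = det(1 + e^{-βh})` for Hermitian `h` — the tree's free-fermion trace formula in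
the universe-polymorphic form `trace_exp_dGamma_smul_add_smul_one` (with `c = 0`).
[cite: DerezinskiGerard2022, §17.2 (Density matrix, display before Def. 17.36)] -/
theorem partitionFn_dGamma_eq_det' {ι : Type*} [LinearOrder ι] [Fintype ι] (β : ℝ)
    {h : Matrix ι ι ℂ} (hh : h.IsHermitian) :
    partitionFn β (dGamma h) = (1 + exp (-(β : ℂ) • h)).det := by
  have h1 := trace_exp_dGamma_smul_add_smul_one hh (-(β : ℂ)) 0
  rw [zero_smul, add_zero] at h1
  rw [partitionFn, gibbsWeight, ← dGamma_smul]
  exact h1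

/-- **The BdG partition function is a determinant.** For Hermitian hopping amplitudes
`conj τ(x,y) = τ(y,x)`, any pairing `Δ`, real `μ`, `β`:
`tr e^{-β H_BdG(τ,Δ,μ)} = e^{-β Σ_x(τ(x,x) - μ)} · det(1 + e^{-β𝓗})`, `𝓗 = bdgNambuMatrix τ Δ μ` —
the finite-volume, inhomogeneous form of the BCS/BdG mean-field partition function
(de Gennes 1966 §5-3; Bach–Lieb–Solovej 1994 §2 for the reduction; Dereziński–Gérard §17.2 for
`Tr Γ(γ) = det(1 + γ)`). [cite: deGennes1966, §5-3] -/
theorem partitionFn_bdgBondHamiltonian {τ : Λ → Λ → ℂ} (hτ : ∀ x y, star (τ x y) = τ y x)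
    (Δ : Λ → Λ → ℂ) (μ β : ℝ) :
    partitionFn β (bdgBondHamiltonian τ Δ μ) =
      Complex.exp (-(β : ℂ) * ∑ x : Λ, (τ x x - μ)) *
        (1 + exp (-(β : ℂ) • bdgNambuMatrix τ Δ μ)).det := by
  have hW : partialParticleHole (spinDownOrbitals : Finset (Orb Λ)) ∈
      unitary (Matrix (Finset (Orb Λ)) (Finset (Orb Λ)) ℂ) :=
    partialParticleHole_mem_unitaryGroup _
  rw [← partitionFn_unitary_conj hW β (bdgBondHamiltonian τ Δ μ), star_eq_conjTranspose,
    partialParticleHole_conj_bdgBondHamiltonian, partitionFn, gibbsWeight_add_smul_one,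
    trace_smul, smul_eq_mul]
  congr 1
  exact partitionFn_dGamma_eq_det' β (isHermitian_bdgNambuMatrix hτ Δ μ)

end Literature.MathematicalPhysics.QuantumLattice

end
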